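import Summits.FinalStateConjecture.FinalStateConjecture.Theorems.ClusterCompletenessAdiabaticMultiKerrILEDRadialFieldWeightedGraph
import Summits.FinalStateConjecture.FinalStateConjecture.Theorems.ClusterCompletenessAdiabaticMultiKerrILEDSlabWeightedExhaustion
import Summits.FinalStateConjecture.FinalStateConjecture.Theorems.ClusterCompletenessAdiabaticMultiKerrILEDRadialFieldDivergence
import Summits.FinalStateConjecture.FinalStateConjecture.Theorems.ClusterCompletenessAdiabaticMultiKerrILEDTailsCutStationary
import Summits.FinalStateConjecture.FinalStateConjecture.Theorems.ClusterCompletenessAdiabaticMultiKerrILEDSmoothTransitionSlope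
import Literature.Analysis.FluidPDE.PassiveScalarProofs
import Literature.Topology.FourManifolds.RadialLinearization

/-!
# Route ClusterCompleteness — crux `AdiabaticMultiKerrILED`, line `Sketch`:
# photon-sphere control of the time derivative (the `ψ̇`-Hardy step of the non-degenerate ILED)

Helper file for the crux `stmt-FinalStateConjecture-14310`
(`Summit.FinalStateConjecture.FinalStateConjecture.Theses.ClusterCompleteness.AdiabaticMultiKerrILED`),
line `Sketch`, stub `restFrame_photonSphere_timeDeriv_le` (lead c7, wave 8).

Setting: one zone, zero spin, rest frame of the static tails-cut Schwarzschild zone (`r = ‖x⃗‖`, profile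
`μ = χ(2 − r/8M) · 2H`), leaves `y ↦ (u + F(y), y)` of a `C²` height `F` of slope `≤ ½`. For `g = ∂₀Φ ∈ C¹` we
integrate the divergence of the spatial radial field `V = (0, h x⃗/‖x⃗‖)`, `h = (r − 3M) θ(r) g²`, with the plateau
cut-off `θ(r) = χ(4r/M − 9) χ(15 − 4r/M)` (`= 1` on `[5M/2, 7M/2]`, `= 0` off `(9M/4, 15M/4)`, `|θ′| ≤ 32/M`, `θ′ = 0`
off the two shells): pointwise `θ g²/6 ≤ div V + 24·𝟙_{shells} g² + 972·𝟙_{annulus} (M² (∂_{r⋆} g)² + (r − 3M)² (∂₀ g)²)`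
on `{r > 2M}` (`photonSphere_pointwise`; `1 − μ ≥ 1/9` there); the weighted slab integral of `div V` is at most the two
end-leaf integrals of `½ Wt |h| ≤ ½ M g²` (`radialField_weighted_graph_le`), the error integrals are converted to
Lebesgue integrals, and the weight is removed by `slab_lintegral_le_of_weighted_le`
(`photonSphere_timeDeriv_le_of_contDiff`, any `g ∈ C¹(ℝ⁴)`, constant `5838`); the **registered stub**
`restFrame_photonSphere_timeDeriv_le` is the case `g = ∂₀Φ`. Dafermos–Rodnianski arXiv:0811.0354, §4.1 (the
`X`-estimate near `r = 3M`); Dafermos–Rodnianski–Shlapentokh-Rothman arXiv:1402.7034, §13.2. [folklore]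
-/

noncomputable section

-- the doubled `FinalStateConjecture.FinalStateConjecture` path component trips dupNamespace
set_option linter.dupNamespace false

open Set Filter Metric MeasureTheory
open scoped BigOperators Topology ENNReal
open Literature.Geometry.Lorentzian
open Literature.Analysis.FluidPDE (ofReal_integral_le_lintegral_ofReal)
open Literature.Topology.FourManifolds (deriv_smoothTransition_eq_zero)

namespace Summit.FinalStateConjecture.FinalStateConjecture.Theorems

/-- **The plateau cut-off** `θ(r) = χ(4r/M − 9) χ(15 − 4r/M)` (`χ` Mathlib's smooth transition, `M > 0`) and its
derivative `θ′ = (4/M)(χ′(4r/M − 9) χ(15 − 4r/M) − χ(4r/M − 9) χ′(15 − 4r/M))`: `0 ≤ θ ≤ 1`, `θ = 1` on `[5M/2, 7M/2]`,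
`θ = 0` off `(9M/4, 15M/4)`, `|θ′| ≤ 32/M` (`|χ′| ≤ 4`), `θ′ = 0` off the shells `[9M/4, 5M/2] ∪ [7M/2, 15M/4]`. [folklore] -/
theorem photonSphere_cutoff_facts {M : ℝ} (hM : 0 < M) (r : ℝ) :
    (0 ≤ Real.smoothTransition (4 * r / M - 9) * Real.smoothTransition (15 - 4 * r / M) ∧
      Real.smoothTransition (4 * r / M - 9) * Real.smoothTransition (15 - 4 * r / M) ≤ 1) ∧
    (5 * M / 2 ≤ r → r ≤ 7 * M / 2 → Real.smoothTransition (4 * r / M - 9) * Real.smoothTransition (15 - 4 * r / M) = 1) ∧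
    (r ≤ 9 * M / 4 ∨ 15 * M / 4 ≤ r → Real.smoothTransition (4 * r / M - 9) * Real.smoothTransition (15 - 4 * r / M) = 0) ∧
    HasDerivAt (fun r ↦ Real.smoothTransition (4 * r / M - 9) * Real.smoothTransition (15 - 4 * r / M))
      (4 / M * (deriv Real.smoothTransition (4 * r / M - 9) * Real.smoothTransition (15 - 4 * r / M) -
        Real.smoothTransition (4 * r / M - 9) * deriv Real.smoothTransition (15 - 4 * r / M))) r ∧
    |4 / M * (deriv Real.smoothTransition (4 * r / M - 9) * Real.smoothTransition (15 - 4 * r / M) -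
        Real.smoothTransition (4 * r / M - 9) * deriv Real.smoothTransition (15 - 4 * r / M))| ≤ 32 / M ∧
    (r < 9 * M / 4 ∨ 15 * M / 4 < r ∨ (5 * M / 2 < r ∧ r < 7 * M / 2) → 4 / M * (deriv Real.smoothTransition (4 * r / M - 9) *
      Real.smoothTransition (15 - 4 * r / M) - Real.smoothTransition (4 * r / M - 9) * deriv Real.smoothTransition (15 - 4 * r / M)) = 0) := by
  set a := 4 * r / M - 9 with ha
  set b := 15 - 4 * r / M with hb
  obtain ⟨ha0, ha1, hb0, hb1⟩ : 0 ≤ Real.smoothTransition a ∧ Real.smoothTransition a ≤ 1 ∧ 0 ≤ Real.smoothTransition b ∧ Real.smoothTransition b ≤ 1 :=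
    ⟨Real.smoothTransition.nonneg a, Real.smoothTransition.le_one a, Real.smoothTransition.nonneg b, Real.smoothTransition.le_one b⟩
  refine ⟨⟨mul_nonneg ha0 hb0, mul_le_one₀ ha1 hb0 hb1⟩, fun h1 h2 ↦ ?_, fun h ↦ ?_, ?_, ?_, fun h ↦ ?_⟩
  · rw [Real.smoothTransition.one_of_one_le (show 1 ≤ a by rw [ha, le_sub_iff_add_le, le_div_iff₀ hM]; linarith),
      Real.smoothTransition.one_of_one_le (show 1 ≤ b by rw [hb, le_sub_comm, div_le_iff₀ hM]; linarith), mul_one]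
  · rcases h with h | h
    · rw [Real.smoothTransition.zero_of_nonpos (show a ≤ 0 by rw [ha, sub_nonpos, div_le_iff₀ hM]; linarith), zero_mul]
    · rw [Real.smoothTransition.zero_of_nonpos (show b ≤ 0 by rw [hb, sub_nonpos, le_div_iff₀ hM]; linarith), mul_zero]
  · have hS : ∀ u : ℝ, HasDerivAt Real.smoothTransition (deriv Real.smoothTransition u) u := fun u ↦
      ((Real.smoothTransition.contDiff (n := 1)).differentiable one_ne_zero u).hasDerivAt
    have hda : HasDerivAt (fun r : ℝ ↦ 4 * r / M - 9) (4 / M) r := by simpa using (((hasDerivAt_id r).const_mul 4).div_const M).sub_const 9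
    have hdb : HasDerivAt (fun r : ℝ ↦ 15 - 4 * r / M) (-(4 / M)) r := by simpa using (((hasDerivAt_id r).const_mul 4).div_const M).const_sub 15
    have hd : HasDerivAt (fun r ↦ Real.smoothTransition (4 * r / M - 9) * Real.smoothTransition (15 - 4 * r / M))
        (deriv Real.smoothTransition a * (4 / M) * Real.smoothTransition b + Real.smoothTransition a * (deriv Real.smoothTransition b * (-(4 / M)))) r :=
      ((hS _).comp r hda).mul ((hS _).comp r hdb)
    exact hd.congr_deriv (by ring)
  · have h1 := abs_le.mp (abs_deriv_smoothTransition_le_four a)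
    have h2 := abs_le.mp (abs_deriv_smoothTransition_le_four b)
    rw [abs_mul, abs_of_pos (by positivity : (0 : ℝ) < 4 / M), show (32 : ℝ) / M = 4 / M * 8 by ring]
    refine mul_le_mul_of_nonneg_left (abs_le.mpr ⟨?_, ?_⟩) (by positivity)
    · nlinarith [mul_nonneg (by linarith : (0 : ℝ) ≤ deriv Real.smoothTransition a + 4) hb0, mul_nonneg (sub_nonneg.mpr h2.2) ha0]
    · nlinarith [mul_nonneg (sub_nonneg.mpr h1.2) hb0, mul_nonneg (by linarith : (0 : ℝ) ≤ deriv Real.smoothTransition b + 4) ha0]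
  · rcases h with h | h | ⟨h1, h2⟩
    · have h' : a < 0 := by rw [ha, sub_neg, div_lt_iff₀ hM]; linarith
      simp [deriv_smoothTransition_eq_zero (Or.inl h'), Real.smoothTransition.zero_of_nonpos h'.le]
    · have h' : b < 0 := by rw [hb, sub_neg, lt_div_iff₀ hM]; linarith
      simp [deriv_smoothTransition_eq_zero (Or.inl h'), Real.smoothTransition.zero_of_nonpos h'.le]
    · simp [deriv_smoothTransition_eq_zero (Or.inr (show 1 < a by rw [ha, lt_sub_iff_add_lt, lt_div_iff₀ hM]; linarith)),
        deriv_smoothTransition_eq_zero (Or.inr (show 1 < b by rw [hb, lt_sub_comm, div_lt_iff₀ hM]; linarith))]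

/-- The pointwise photon-sphere inequality for `div V = (θ + (r − 3M) D) g² + 2 (r − 3M) θ g ρ + 2 (r − 3M) θ g²/r`:
`θ g²/6 ≤ div V + Sg + 6 θ (r − 3M)² ρ²` whenever `θ (8r − 18M) ≥ 0` and `(r − 3M) D g² + Sg ≥ 0` (complete the square in
`g + 6 (r − 3M) ρ`). [folklore] -/
theorem photonSphere_pointwise_alg {M r θ D g ρ Sg dv : ℝ} (hr : 0 < r) (hθ : 0 ≤ θ) (hkey : 0 ≤ θ * (8 * r - 18 * M))
    (hS : 0 ≤ (r - 3 * M) * D * g ^ 2 + Sg) (hdv : dv = (θ + (r - 3 * M) * D) * g ^ 2 + 2 * (r - 3 * M) * θ * g * ρ + 2 * (r - 3 * M) * θ * g ^ 2 / r) :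
    θ * g ^ 2 / 6 ≤ dv + Sg + 6 * θ * (r - 3 * M) ^ 2 * ρ ^ 2 := by
  have e : dv + Sg + 6 * θ * (r - 3 * M) ^ 2 * ρ ^ 2 - θ * g ^ 2 / 6 = θ * (8 * r - 18 * M) * g ^ 2 / (3 * r) +
      θ / 6 * (g + 6 * (r - 3 * M) * ρ) ^ 2 + ((r - 3 * M) * D * g ^ 2 + Sg) := by rw [hdv]; field_simp; ring
  have h1 : 0 ≤ θ * (8 * r - 18 * M) * g ^ 2 / (3 * r) := by positivity
  have h2 : 0 ≤ θ / 6 * (g + 6 * (r - 3 * M) * ρ) ^ 2 := by positivity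
  linarith

/-- Elimination of `ρ = (x⃗·∇g)/r` in favour of the tortoise derivative `D⋆ = (1 − μ) ρ + μ g₀`:
`(r − 3M)² ρ² ≤ 162 (M² D⋆² + (r − 3M)² g₀²)` when `1 − μ ≥ 1/9`, `0 ≤ μ ≤ 1`, `(r − 3M)² ≤ M²`. [folklore] -/
theorem photonSphere_rho_sq_le {M r μ ρ g₀ Ds : ℝ} (hμ0 : 0 ≤ μ) (hμ1 : μ ≤ 1) (hf : 1 / 9 ≤ 1 - μ) (hDs : Ds = (1 - μ) * ρ + μ * g₀)
    (hrM : (r - 3 * M) ^ 2 ≤ M ^ 2) : (r - 3 * M) ^ 2 * ρ ^ 2 ≤ 162 * (M ^ 2 * Ds ^ 2 + (r - 3 * M) ^ 2 * g₀ ^ 2) := by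
  have s0 : (1 - μ) * ρ = Ds - μ * g₀ := by rw [hDs]; ring
  have s1 : ρ ^ 2 ≤ 81 * (Ds - μ * g₀) ^ 2 := by
    have h81 : 1 ≤ 81 * (1 - μ) ^ 2 := by nlinarith
    rw [← s0]
    nlinarith [sq_nonneg ρ, mul_le_mul_of_nonneg_right h81 (sq_nonneg ρ)]
  have s2 : (Ds - μ * g₀) ^ 2 ≤ 2 * Ds ^ 2 + 2 * g₀ ^ 2 := by
    nlinarith [sq_nonneg (Ds + μ * g₀), mul_le_mul_of_nonneg_right (by nlinarith : μ ^ 2 ≤ 1) (sq_nonneg g₀)]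
  have s4 : (r - 3 * M) ^ 2 * ρ ^ 2 ≤ (r - 3 * M) ^ 2 * (162 * (Ds ^ 2 + g₀ ^ 2)) := mul_le_mul_of_nonneg_left (by linarith) (sq_nonneg _)
  nlinarith [mul_le_mul_of_nonneg_right hrM (sq_nonneg Ds)]

/-- **Divergence of the radial field** `V = (0, P(r) g² x⃗/‖x⃗‖)` off the time axis: `∑_μ ∂_μ V^μ = P′ g² + 2 P g ρ + 2 P g²/r`,
`ρ = (x⃗·∇g)/r` (`sum_fderiv_radialField` and `x⃗·∇(P(r) g²) = P′ r g² + 2 P g (x⃗·∇g)`). [folklore] -/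
theorem photonSphere_divV_eq {P : ℝ → ℝ} {P' r : ℝ} {g : E4 → ℝ} {x : E4} (hr : Kerr.radius 0 x = r) (h0 : 0 < r) (hP : HasDerivAt P P' r)
    (hg : DifferentiableAt ℝ g x) :
    ∑ μ, fderiv ℝ (fun z : E4 ↦ if μ = 0 then (0 : ℝ) else (P (Kerr.radius 0 z) * g z ^ 2) * z μ / E4.spatialNorm z) x (E4.basisVector μ) =
      P' * g x ^ 2 + 2 * P r * g x * ((∑ i : Fin 3, x i.succ * fderiv ℝ g x (E4.basisVector i.succ)) / r) + 2 * P r * g x ^ 2 / r := by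
  have hxr : E4.spatialNorm x = r := by rw [← Kerr.radius_zero_left, hr]
  have hPc := hardy_hasFDerivAt_comp_radius hr h0 hP
  have hcomp : ∀ i : Fin 3, fderiv ℝ (fun z ↦ P (Kerr.radius 0 z) * g z ^ 2) x (E4.basisVector i.succ) =
      P' * r⁻¹ * x i.succ * g x ^ 2 + P r * (2 * g x * fderiv ℝ g x (E4.basisVector i.succ)) := fun i ↦ by
    rw [(hPc.fun_mul (hg.hasFDerivAt.pow 2)).fderiv]
    fin_cases i <;> simp [hr] <;> ring
  have hu : r⁻¹ * (x 1 ^ 2 + x 2 ^ 2 + x 3 ^ 2) = r := by rw [← E4.spatialNorm_sq, hxr]; field_simp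
  have hsum : ∑ i : Fin 3, x i.succ * fderiv ℝ (fun z ↦ P (Kerr.radius 0 z) * g z ^ 2) x (E4.basisVector i.succ) =
      P' * r * g x ^ 2 + 2 * P r * g x * ∑ i : Fin 3, x i.succ * fderiv ℝ g x (E4.basisVector i.succ) := by
    simp only [hcomp, Fin.sum_univ_three, Fin.succ_zero_eq_one, Fin.succ_one_eq_two, Kerr.fin_succ_two_eq_three]
    linear_combination P' * g x ^ 2 * hu
  rw [sum_fderiv_radialField (fun z ↦ P (Kerr.radius 0 z) * g z ^ 2) x (hxr ▸ h0) (hPc.differentiableAt.mul (hg.pow 2)), hsum, hxr, hr]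
  field_simp

/-- **The divergence of `(0, h x⃗/‖x⃗‖)` is continuous off the time axis** when `h` is `C¹` there. [folklore] -/
theorem photonSphere_continuousAt_divV {h : E4 → ℝ} {x : E4} (h0 : 0 < Kerr.radius 0 x) (hh : ContDiffAt ℝ 1 h x) :
    ContinuousAt (fun y ↦ ∑ μ, fderiv ℝ (fun z : E4 ↦ if μ = 0 then (0 : ℝ) else h z * z μ / E4.spatialNorm z) y (E4.basisVector μ)) x := by
  have hsn : E4.spatialNorm = Kerr.radius 0 := funext fun z ↦ (Kerr.radius_zero_left z).symm
  refine tendsto_finsetSum _ fun μ _ ↦ ?_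
  by_cases hμ : μ = 0
  · subst hμ
    simp only [↓reduceIte, fderiv_const_apply]
    exact continuousAt_const
  · simp only [hμ, ↓reduceIte]
    have hV : ContDiffAt ℝ 1 (fun z : E4 ↦ h z * z μ / E4.spatialNorm z) x :=
      (hh.mul (Kerr.contDiff_coord μ).contDiffAt).div (by rw [hsn]; exact Kerr.contDiffAt_radius h0) (by rw [← Kerr.radius_zero_left]; exact h0.ne')
    exact (hV.continuousAt_fderiv one_ne_zero).clm_apply continuousAt_const

/-- **The pointwise photon-sphere inequality** for `h = (r − 3M) θ(r) g²` at a point off the time axis: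
`θ g²/6 − div V ≤ 24·𝟙_{shells} g² + 972·𝟙_{annulus} (M² D⋆² + (r − 3M)² (∂₀ g)²)`, `D⋆ = (1 − μ)(x⃗·∇g)/r + μ ∂₀g` for any `μ`
with `0 ≤ μ ≤ 8/9` on the annulus (off the annulus `θ = θ′ = 0` and the left side vanishes). [folklore] -/
theorem photonSphere_pointwise {M : ℝ} (hM : 0 < M) {g : E4 → ℝ} (hg : ContDiff ℝ 1 g) {x : E4} {r : ℝ} (hr : Kerr.radius 0 x = r) (h0 : 0 < r) {μ : ℝ}
    (hμ : 9 * M / 4 ≤ r → r ≤ 15 * M / 4 → 0 ≤ μ ∧ μ ≤ 8 / 9) :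
    Real.smoothTransition (4 * r / M - 9) * Real.smoothTransition (15 - 4 * r / M) * g x ^ 2 / 6 -
      ∑ ν, fderiv ℝ (fun z : E4 ↦ if ν = 0 then (0 : ℝ) else ((Kerr.radius 0 z - 3 * M) * (Real.smoothTransition (4 * Kerr.radius 0 z / M - 9) *
        Real.smoothTransition (15 - 4 * Kerr.radius 0 z / M)) * g z ^ 2) * z ν / E4.spatialNorm z) x (E4.basisVector ν) ≤
      (if (9 * M / 4 ≤ r ∧ r ≤ 5 * M / 2) ∨ (7 * M / 2 ≤ r ∧ r ≤ 15 * M / 4) then 24 * g x ^ 2 else 0) +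
      (if 9 * M / 4 ≤ r ∧ r ≤ 15 * M / 4 then 972 * (M ^ 2 * ((1 - μ) * (∑ i : Fin 3, x i.succ * fderiv ℝ g x (E4.basisVector i.succ)) / r +
        μ * fderiv ℝ g x (E4.basisVector 0)) ^ 2 + (r - 3 * M) ^ 2 * fderiv ℝ g x (E4.basisVector 0) ^ 2) else 0) := by
  obtain ⟨hθm, -, hθ0, hθd, hDb, hD0⟩ := photonSphere_cutoff_facts hM r
  set θ : ℝ := Real.smoothTransition (4 * r / M - 9) * Real.smoothTransition (15 - 4 * r / M) with hθ
  set D : ℝ := 4 / M * (deriv Real.smoothTransition (4 * r / M - 9) * Real.smoothTransition (15 - 4 * r / M) -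
    Real.smoothTransition (4 * r / M - 9) * deriv Real.smoothTransition (15 - 4 * r / M)) with hD
  have hP : HasDerivAt (fun s ↦ (s - 3 * M) * (Real.smoothTransition (4 * s / M - 9) * Real.smoothTransition (15 - 4 * s / M)))
      (1 * θ + (r - 3 * M) * D) r := ((hasDerivAt_id r).sub_const (3 * M)).mul hθd
  rw [photonSphere_divV_eq hr h0 hP (hg.differentiable one_ne_zero x)]
  simp only [← hθ]
  set ρ : ℝ := (∑ i : Fin 3, x i.succ * fderiv ℝ g x (E4.basisVector i.succ)) / r with hρ
  set g₀ : ℝ := fderiv ℝ g x (E4.basisVector 0)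
  by_cases han : 9 * M / 4 ≤ r ∧ r ≤ 15 * M / 4
  · rw [if_pos han]
    obtain ⟨hμ0, hμ1⟩ := hμ han.1 han.2
    have hSD : 0 ≤ (r - 3 * M) * D * g x ^ 2 + (if (9 * M / 4 ≤ r ∧ r ≤ 5 * M / 2) ∨ (7 * M / 2 ≤ r ∧ r ≤ 15 * M / 4) then 24 * g x ^ 2 else 0) := by
      split_ifs with hsh
      · have hb : |(r - 3 * M) * D| ≤ 3 * M / 4 * (32 / M) := by
          rw [abs_mul]; exact mul_le_mul (abs_le.mpr ⟨by linarith, by linarith⟩) hDb (abs_nonneg _) (by positivity)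
        rw [show 3 * M / 4 * (32 / M) = 24 by field_simp; ring] at hb
        nlinarith [neg_abs_le ((r - 3 * M) * D), sq_nonneg (g x)]
      · rw [show D = 0 from hD0 (Or.inr (Or.inr ⟨lt_of_not_ge fun h ↦ hsh (Or.inl ⟨han.1, h⟩), lt_of_not_ge fun h ↦ hsh (Or.inr ⟨h, han.2⟩)⟩))]
        simp
    have hP1 := photonSphere_pointwise_alg (ρ := ρ) h0 hθm.1 (mul_nonneg hθm.1 (by linarith)) hSD
      (dv := (1 * θ + (r - 3 * M) * D) * g x ^ 2 + 2 * ((r - 3 * M) * θ) * g x * ρ + 2 * ((r - 3 * M) * θ) * g x ^ 2 / r) (by ring)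
    have hDs : (1 - μ) * (∑ i : Fin 3, x i.succ * fderiv ℝ g x (E4.basisVector i.succ)) / r + μ * g₀ = (1 - μ) * ρ + μ * g₀ := by rw [hρ, mul_div_assoc]
    have hP2 := photonSphere_rho_sq_le (ρ := ρ) hμ0 (by linarith) (by linarith) hDs (by nlinarith : (r - 3 * M) ^ 2 ≤ M ^ 2)
    have hT0 : 0 ≤ M ^ 2 * ((1 - μ) * (∑ i : Fin 3, x i.succ * fderiv ℝ g x (E4.basisVector i.succ)) / r + μ * g₀) ^ 2 + (r - 3 * M) ^ 2 * g₀ ^ 2 := by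
      positivity
    nlinarith [mul_le_mul_of_nonneg_left hP2 hθm.1, mul_le_of_le_one_left hT0 hθm.2]
  · have hoff : r < 9 * M / 4 ∨ 15 * M / 4 < r := (lt_or_ge r (9 * M / 4)).imp id fun h1 ↦ lt_of_not_ge (not_and.mp han h1)
    rw [if_neg han, if_neg fun h ↦ han (h.elim (fun h1 ↦ ⟨h1.1, by linarith [h1.2]⟩) fun h2 ↦ ⟨by linarith [h2.1], h2.2⟩),
      show θ = 0 from hθ0 (hoff.imp le_of_lt le_of_lt), show D = 0 from hD0 (hoff.elim Or.inl fun h ↦ Or.inr (Or.inl h))]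
    simp

/-- **Photon-sphere control of a `C¹` function `g` on the leaves of the static zone** (the stub with `∂₀Φ` replaced by an
arbitrary `g ∈ C¹(ℝ⁴)`, constant `5838`): integrate `photonSphere_pointwise` against the static weight `Wt_{ε,4M}`, bound the
weighted divergence by `radialField_weighted_graph_le` (`|h| ≤ M g²`, `h = 0` for `r ≤ 9M/4`), convert the error and flux
integrals to Lebesgue integrals, and remove the weight by `slab_lintegral_le_of_weighted_le` (`θ = 1` on `[5M/2, 7M/2]`). [folklore] -/
theorem photonSphere_timeDeriv_le_of_contDiff (M : ℝ) (hM : 0 < M) (F : E3 → ℝ) (g : E4 → ℝ) (s : ℝ) (hF : ContDiff ℝ 2 F)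
    (hdF : ∀ y, ‖fderiv ℝ F y‖ ≤ 2⁻¹) (hg : ContDiff ℝ 1 g) (hs : 0 ≤ s) :
    let L : ℝ → E3 → E4 := fun u y ↦ E4.ofTimeSpace (u + F y) y
    let pf : E4 → ℝ := fun z ↦ Real.smoothTransition (2 - Kerr.radius 0 z / (8 * M)) * (2 * Kerr.scalarH M 0 z)
    ∫⁻ u in Set.Ioc 0 s, ∫⁻ y in {y : E3 | 5 * M / 2 ≤ ‖y‖ ∧ ‖y‖ ≤ 7 * M / 2}, ENNReal.ofReal (g (L u y) ^ 2) ≤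
      ((5838 : NNReal) : ℝ≥0∞) * (ENNReal.ofReal M * (∫⁻ y in {y : E3 | 2 * M < ‖y‖}, ENNReal.ofReal (g (L 0 y) ^ 2)) +
        ENNReal.ofReal M * (∫⁻ y in {y : E3 | 2 * M < ‖y‖}, ENNReal.ofReal (g (L s y) ^ 2)) +
        (∫⁻ u in Set.Ioc 0 s, ∫⁻ y in {y : E3 | (9 * M / 4 ≤ ‖y‖ ∧ ‖y‖ ≤ 5 * M / 2) ∨ (7 * M / 2 ≤ ‖y‖ ∧ ‖y‖ ≤ 15 * M / 4)}, ENNReal.ofReal (g (L u y) ^ 2)) +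
        (∫⁻ u in Set.Ioc 0 s, ∫⁻ y in {y : E3 | 9 * M / 4 ≤ ‖y‖ ∧ ‖y‖ ≤ 15 * M / 4}, ENNReal.ofReal (M ^ 2 * ((1 - pf (L u y)) *
          (∑ i : Fin 3, (L u y) i.succ * fderiv ℝ g (L u y) (E4.basisVector i.succ)) / Kerr.radius 0 (L u y) + pf (L u y) * fderiv ℝ g (L u y) (E4.basisVector 0)) ^ 2 +
          (‖y‖ - 3 * M) ^ 2 * fderiv ℝ g (L u y) (E4.basisVector 0) ^ 2))) := by
  intro L pf
  set θ : ℝ → ℝ := fun r ↦ Real.smoothTransition (4 * r / M - 9) * Real.smoothTransition (15 - 4 * r / M) with hθ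
  set h : E4 → ℝ := fun z ↦ ((Kerr.radius 0 z - 3 * M) * θ (Kerr.radius 0 z)) * g z ^ 2 with hh
  set b : E4 → ℝ := fun z ↦ θ (Kerr.radius 0 z) * g z ^ 2 / 6 with hb
  set dV : E4 → ℝ := fun x ↦ ∑ ν, fderiv ℝ (fun z : E4 ↦ if ν = 0 then (0 : ℝ) else h z * z ν / E4.spatialNorm z) x (E4.basisVector ν)
  set T : ℝ → E3 → ℝ := fun u y ↦ M ^ 2 * ((1 - pf (L u y)) * (∑ i : Fin 3, (L u y) i.succ * fderiv ℝ g (L u y) (E4.basisVector i.succ)) /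
    Kerr.radius 0 (L u y) + pf (L u y) * fderiv ℝ g (L u y) (E4.basisVector 0)) ^ 2 + (‖y‖ - 3 * M) ^ 2 * fderiv ℝ g (L u y) (E4.basisVector 0) ^ 2 with hT
  set G2 : ℝ → E3 → ℝ≥0∞ := fun u y ↦ ENNReal.ofReal (g (L u y) ^ 2) with hG2
  set S0 : Set E3 := {y | 2 * M < ‖y‖}
  set mid : Set E3 := {y | 5 * M / 2 ≤ ‖y‖ ∧ ‖y‖ ≤ 7 * M / 2}
  set sh : Set E3 := {y | (9 * M / 4 ≤ ‖y‖ ∧ ‖y‖ ≤ 5 * M / 2) ∨ (7 * M / 2 ≤ ‖y‖ ∧ ‖y‖ ≤ 15 * M / 4)} with hsh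
  set an : Set E3 := {y | 9 * M / 4 ≤ ‖y‖ ∧ ‖y‖ ≤ 15 * M / 4} with han
  set Stot : ℝ≥0∞ := ENNReal.ofReal M * (∫⁻ y in S0, G2 0 y) + ENNReal.ofReal M * (∫⁻ y in S0, G2 s y) +
    (∫⁻ u in Ioc 0 s, ∫⁻ y in sh, G2 u y) + (∫⁻ u in Ioc 0 s, ∫⁻ y in an, ENNReal.ofReal (T u y))
  show ∫⁻ u in Ioc 0 s, ∫⁻ y in mid, G2 u y ≤ ((5838 : NNReal) : ℝ≥0∞) * Stot
  rcases eq_or_ne Stot ∞ with htop | htop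
  · rw [htop, ENNReal.mul_top (by norm_num)]; exact le_top
  have hfin0 : ENNReal.ofReal M * (∫⁻ y in S0, G2 0 y) ≠ ∞ := ne_top_of_le_ne_top htop (le_add_right (le_add_right (le_add_right le_rfl)))
  have hfins : ENNReal.ofReal M * (∫⁻ y in S0, G2 s y) ≠ ∞ := ne_top_of_le_ne_top htop (le_add_right (le_add_right (le_add_left le_rfl)))
  have hLu : ∀ u, Continuous (L u) := fun u ↦ E4.continuous_ofTimeSpace' (continuous_const.add hF.continuous) continuous_id
  have hLc : Continuous fun z : ℝ × E3 ↦ L z.1 z.2 := E4.continuous_ofTimeSpace' (continuous_fst.add (hF.continuous.comp continuous_snd)) continuous_snd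
  have hLnorm : ∀ u y, E4.spatialNorm (L u y) = ‖y‖ := fun u y ↦ E4.spatialNorm_ofTimeSpace _ _
  have hLrad : ∀ u y, Kerr.radius 0 (L u y) = ‖y‖ := fun u y ↦ by rw [Kerr.radius_zero_left, hLnorm]
  have hθm : ∀ r, 0 ≤ θ r ∧ θ r ≤ 1 := fun r ↦ (photonSphere_cutoff_facts hM r).1
  have hθ0 : ∀ r, r ≤ 9 * M / 4 ∨ 15 * M / 4 ≤ r → θ r = 0 := fun r hr ↦ (photonSphere_cutoff_facts hM r).2.2.1 hr
  have hθC : ContDiff ℝ 1 θ := (Real.smoothTransition.contDiff.comp (((contDiff_const.mul contDiff_id).div_const M).sub contDiff_const)).mul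
    (Real.smoothTransition.contDiff.comp (contDiff_const.sub ((contDiff_const.mul contDiff_id).div_const M)))
  have hgc : Continuous g := hg.continuous
  have hh0 : ∀ x, θ (Kerr.radius 0 x) = 0 → h x = 0 := fun x hx ↦ by simp only [hh, hx, mul_zero, zero_mul]
  have hhC : ∀ x, 2 * M < Kerr.radius 0 x → ContDiffAt ℝ 1 h x := fun x hx ↦
    (((contDiff_id.sub contDiff_const).mul hθC).contDiffAt.comp x (Kerr.contDiffAt_radius (by linarith))).mul (hg.contDiffAt.pow 2)
  have hb0 : ∀ x, 0 ≤ b x := fun x ↦ div_nonneg (mul_nonneg (hθm _).1 (sq_nonneg _)) (by norm_num)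
  have hbc : Continuous b := ((hθC.continuous.comp (Kerr.continuous_radius 0)).mul (hgc.pow 2)).div_const 6
  have hdVc : ∀ x, 2 * M < Kerr.radius 0 x → ContinuousAt dV x := fun x hx ↦ photonSphere_continuousAt_divV (by linarith) (hhC x hx)
  have hT0 : ∀ u y, 0 ≤ T u y := fun u y ↦ by simp only [hT]; positivity
  have habs : ∀ u y, |h (L u y)| ≤ M * g (L u y) ^ 2 := fun u y ↦ by
    simp only [hh, hLrad, abs_mul, abs_of_nonneg (sq_nonneg (g (L u y)))]
    refine mul_le_mul_of_nonneg_right ?_ (sq_nonneg _)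
    by_cases hin : ‖y‖ ≤ 9 * M / 4 ∨ 15 * M / 4 ≤ ‖y‖
    · rw [hθ0 _ hin, abs_zero, mul_zero]; exact hM.le
    · push Not at hin; rw [abs_of_nonneg (hθm _).1]
      exact (mul_le_mul (abs_le.mpr ⟨by linarith [hin.1], by linarith [hin.2]⟩) (hθm _).2 (hθm _).1 hM.le).trans_eq (mul_one M)
  have hpw : ∀ u y, 2 * M < ‖y‖ → b (L u y) - dV (L u y) ≤ (if y ∈ sh then 24 * g (L u y) ^ 2 else 0) + (if y ∈ an then 972 * T u y else 0) := by
    intro u y hy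
    have hμ : 9 * M / 4 ≤ Kerr.radius 0 (L u y) → Kerr.radius 0 (L u y) ≤ 15 * M / 4 → 0 ≤ pf (L u y) ∧ pf (L u y) ≤ 8 / 9 := by
      rw [hLrad]; intro h1 h2
      rw [show pf (L u y) = 2 * M / ‖y‖ from (tailsCut_profile_eq_of_radius_le M 0 (L u y) hM (by rw [hLrad]; linarith)).trans
        (by rw [hardy_scalarH_zero, hLrad, mul_div_assoc]), div_le_iff₀ (by linarith)]
      exact ⟨by positivity, by linarith⟩
    refine (photonSphere_pointwise hM hg (x := L u y) rfl (by rw [hLrad]; linarith) hμ).trans (le_of_eq ?_)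
    simp only [hT, hLrad, hsh, han, mem_setOf_eq]
  -- ### the weighted slab inequality, uniformly in the admissible `ε`, and the removal of the weight
  set A : ℝ := (972 * Stot).toReal + 2⁻¹ * Stot.toReal + 2⁻¹ * Stot.toReal with hA
  have hweighted : ∀ ε : ℝ, 0 < ε → 16 * ε * Real.exp ((s + |F 0| + 2 * (4 * M)) / (2 * M)) ≤ M →
      ∫ u in Set.Ioc 0 s, ∫ y : E3, (Real.smoothTransition (Kerr.horizonFn M 0 (E4.ofTimeSpace (u + F y) y) / ε - 1) *
        Real.smoothTransition (2 - E4.spatialNorm (E4.ofTimeSpace (u + F y) y) ^ 2 / (4 * M) ^ 2)) * b (E4.ofTimeSpace (u + F y) y) ≤ A := by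
    intro ε hε hεM
    set W : E4 → ℝ := fun x ↦ Real.smoothTransition (Kerr.horizonFn M 0 x / ε - 1) * Real.smoothTransition (2 - E4.spatialNorm x ^ 2 / (4 * M) ^ 2)
    show ∫ u in Ioc 0 s, ∫ y, W (L u y) * b (L u y) ≤ A
    have hW0 : ∀ x, 0 ≤ W x := fun x ↦ mul_nonneg (Real.smoothTransition.nonneg _) (Real.smoothTransition.nonneg _)
    have hW1 : ∀ x, W x ≤ 1 := fun x ↦ mul_le_one₀ (Real.smoothTransition.le_one _) (Real.smoothTransition.nonneg _) (Real.smoothTransition.le_one _)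
    have hWr : ∀ x, Kerr.radius 0 x ≤ 2 * M → W x = 0 := fun x hx ↦ tailsCutWeight_eq_zero_of_horizonFn_lt hε (lt_of_le_of_lt
      (by unfold Kerr.horizonFn; rw [Kerr.rPlus_zero_right hM.le]; exact mul_nonpos_iff.mpr (Or.inr ⟨by linarith, (Real.exp_pos _).le⟩)) hε)
    have hWfar : ∀ u y, y ∉ closedBall (0 : E3) (2 * (4 * M)) → W (L u y) = 0 := fun u y hy ↦ by
      rw [mem_closedBall_zero_iff, not_le] at hy
      exact tailsCutWeight_eq_zero_of_lt_spatialNorm_sq (by positivity) (by rw [hLnorm]; nlinarith)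
    have hV : ∫ u in Ioc 0 s, ∫ y, W (L u y) * dV (L u y) ≤ 2⁻¹ * (∫ y, W (L 0 y) * |h (L 0 y)|) + 2⁻¹ * (∫ y, W (L s y) * |h (L s y)|) :=
      radialField_weighted_graph_le M ε (4 * M) F h s hM hε (by positivity) hεM hF hdF hs hhC
        (fun x _ hx2 ↦ (hh0 x (hθ0 _ (Or.inl (by rw [Kerr.radius_zero_left]; linarith)))).symm.le)
        (fun x hx ↦ hh0 x (hθ0 _ (Or.inr (by rw [Kerr.radius_zero_left]; linarith))))
    have hint : ∀ φ : E4 → ℝ, Continuous (fun x ↦ W x * φ x) → (∀ u, Integrable fun y ↦ W (L u y) * φ (L u y)) ∧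
        IntegrableOn (fun u ↦ ∫ y, W (L u y) * φ (L u y)) (Ioc 0 s) := by
      intro φ hφ
      have hz : ∀ u y, y ∉ closedBall (0 : E3) (2 * (4 * M)) → W (L u y) * φ (L u y) = 0 := fun u y hy ↦ by rw [hWfar u y hy, zero_mul]
      refine ⟨fun u ↦ (show Continuous fun y ↦ W (L u y) * φ (L u y) from hφ.comp (hLu u)).integrable_of_hasCompactSupport
        (HasCompactSupport.intro (isCompact_closedBall _ _) (hz u)), (Continuous.integrableOn_Icc ?_).mono_set Ioc_subset_Icc_self⟩
      exact (continuous_parametric_integral_of_continuous (f := fun (u : ℝ) (y : E3) ↦ W (L u y) * φ (L u y)) (hφ.comp hLc)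
        (isCompact_closedBall (0 : E3) (2 * (4 * M)))).congr fun u ↦ setIntegral_eq_integral_of_forall_compl_eq_zero (hz u)
    obtain ⟨hib, hIb⟩ := hint b (continuous_tailsCutWeight_mul (4 * M) hM hε fun x _ ↦ hbc.continuousAt)
    obtain ⟨hid, hId⟩ := hint dV (continuous_tailsCutWeight_mul (4 * M) hM hε hdVc)
    have hshm : MeasurableSet sh := ((isClosed_le continuous_const continuous_norm).measurableSet.inter
      (isClosed_le continuous_norm continuous_const).measurableSet).union ((isClosed_le continuous_const continuous_norm).measurableSet.inter
      (isClosed_le continuous_norm continuous_const).measurableSet)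
    have hanm : MeasurableSet an := (isClosed_le continuous_const continuous_norm).measurableSet.inter (isClosed_le continuous_norm continuous_const).measurableSet
    have hPm : Measurable fun u ↦ ∫⁻ y in sh, G2 u y :=
      (ENNReal.measurable_ofReal.comp ((hgc.comp hLc).pow 2).measurable).lintegral_prod_right' (ν := volume.restrict sh)
    have hleaf : ∀ u, ENNReal.ofReal ((∫ y, W (L u y) * b (L u y)) - ∫ y, W (L u y) * dV (L u y)) ≤
        24 * (∫⁻ y in sh, G2 u y) + 972 * ∫⁻ y in an, ENNReal.ofReal (T u y) := by
      intro u
      rw [← integral_sub (hib u) (hid u)]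
      refine (ofReal_integral_le_lintegral_ofReal _).trans ?_
      have hm1 : Measurable fun y ↦ sh.indicator (fun y ↦ 24 * G2 u y) y :=
        ((ENNReal.measurable_ofReal.comp ((hgc.comp (hLu u)).pow 2).measurable).const_mul _).indicator hshm
      calc ∫⁻ y, ENNReal.ofReal (W (L u y) * b (L u y) - W (L u y) * dV (L u y))
          ≤ ∫⁻ y, (sh.indicator (fun y ↦ 24 * G2 u y) y + an.indicator (fun y ↦ 972 * ENNReal.ofReal (T u y)) y) := by
            refine lintegral_mono fun y ↦ ?_
            by_cases hy2 : 2 * M < ‖y‖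
            · have hrhs0 : 0 ≤ (if y ∈ sh then 24 * g (L u y) ^ 2 else 0) + (if y ∈ an then 972 * T u y else 0) :=
                add_nonneg (by split_ifs; positivity; exact le_rfl) (by split_ifs; exact mul_nonneg (by norm_num) (hT0 u y); exact le_rfl)
              have hle : W (L u y) * b (L u y) - W (L u y) * dV (L u y) ≤ (if y ∈ sh then 24 * g (L u y) ^ 2 else 0) + (if y ∈ an then 972 * T u y else 0) := by
                rw [← mul_sub]
                exact (mul_le_mul_of_nonneg_left (hpw u y hy2) (hW0 _)).trans (mul_le_of_le_one_left hrhs0 (hW1 _))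
              refine (ENNReal.ofReal_le_ofReal hle).trans (le_of_eq ?_)
              by_cases hys : y ∈ sh
              · have hya : y ∈ an := hys.elim (fun h1 ↦ ⟨h1.1, by linarith [h1.2]⟩) fun h2 ↦ ⟨by linarith [h2.1], h2.2⟩
                rw [if_pos hys, if_pos hya, indicator_of_mem hys, indicator_of_mem hya, ENNReal.ofReal_add (by positivity) (mul_nonneg (by norm_num) (hT0 u y)),
                  ENNReal.ofReal_mul (by norm_num), ENNReal.ofReal_mul (by norm_num), ENNReal.ofReal_ofNat, ENNReal.ofReal_ofNat]
              · by_cases hya : y ∈ an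
                · rw [if_neg hys, if_pos hya, indicator_of_notMem hys, indicator_of_mem hya, zero_add, zero_add, ENNReal.ofReal_mul (by norm_num), ENNReal.ofReal_ofNat]
                · rw [if_neg hys, if_neg hya, indicator_of_notMem hys, indicator_of_notMem hya, add_zero, add_zero, ENNReal.ofReal_zero]
            · rw [hWr _ (by rw [hLrad]; exact not_lt.mp hy2), zero_mul, zero_mul, sub_zero, ENNReal.ofReal_zero]
              exact zero_le
        _ = 24 * (∫⁻ y in sh, G2 u y) + 972 * ∫⁻ y in an, ENNReal.ofReal (T u y) := by
            rw [lintegral_add_left hm1, lintegral_indicator hshm, lintegral_indicator hanm, lintegral_const_mul' _ _ (by norm_num), lintegral_const_mul' _ _ (by norm_num)]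
    have herr : (∫ u in Ioc 0 s, ((∫ y, W (L u y) * b (L u y)) - ∫ y, W (L u y) * dV (L u y))) ≤ (972 * Stot).toReal := by
      refine (ENNReal.ofReal_le_iff_le_toReal (ENNReal.mul_ne_top (by norm_num) htop)).mp ((ofReal_integral_le_lintegral_ofReal _).trans ?_)
      calc ∫⁻ u in Ioc 0 s, ENNReal.ofReal ((∫ y, W (L u y) * b (L u y)) - ∫ y, W (L u y) * dV (L u y))
          ≤ ∫⁻ u in Ioc 0 s, (24 * (∫⁻ y in sh, G2 u y) + 972 * ∫⁻ y in an, ENNReal.ofReal (T u y)) := lintegral_mono fun u ↦ hleaf u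
        _ = 24 * (∫⁻ u in Ioc 0 s, ∫⁻ y in sh, G2 u y) + 972 * ∫⁻ u in Ioc 0 s, ∫⁻ y in an, ENNReal.ofReal (T u y) := by
            rw [lintegral_add_left (hPm.const_mul _), lintegral_const_mul' _ _ (by norm_num), lintegral_const_mul' _ _ (by norm_num)]
        _ ≤ 972 * (∫⁻ u in Ioc 0 s, ∫⁻ y in sh, G2 u y) + 972 * ∫⁻ u in Ioc 0 s, ∫⁻ y in an, ENNReal.ofReal (T u y) := by gcongr; norm_num
        _ ≤ 972 * Stot := by rw [← mul_add]; exact mul_le_mul' le_rfl (add_le_add (le_add_left le_rfl) le_rfl)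
    have hflux : ∀ t, ENNReal.ofReal M * (∫⁻ y in S0, G2 t y) ≠ ∞ → ∫ y, W (L t y) * |h (L t y)| ≤ (ENNReal.ofReal M * ∫⁻ y in S0, G2 t y).toReal := by
      intro t hfin
      refine (ENNReal.ofReal_le_iff_le_toReal hfin).mp ((ofReal_integral_le_lintegral_ofReal _).trans ?_)
      calc ∫⁻ y, ENNReal.ofReal (W (L t y) * |h (L t y)|) ≤ ∫⁻ y, S0.indicator (fun y ↦ ENNReal.ofReal M * G2 t y) y := by
            refine lintegral_mono fun y ↦ ?_
            by_cases hy : y ∈ S0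
            · rw [indicator_of_mem hy, hG2, ← ENNReal.ofReal_mul hM.le]
              exact ENNReal.ofReal_le_ofReal ((mul_le_mul_of_nonneg_right (hW1 _) (abs_nonneg _)).trans (by rw [one_mul]; exact habs t y))
            · have hy' : ‖y‖ ≤ 2 * M := not_lt.mp hy
              rw [indicator_of_notMem hy, hh0 _ (hθ0 _ (Or.inl (by rw [hLrad]; linarith))), abs_zero, mul_zero, ENNReal.ofReal_zero]
        _ = ENNReal.ofReal M * ∫⁻ y in S0, G2 t y := by
            rw [lintegral_indicator (isOpen_lt continuous_const continuous_norm).measurableSet, lintegral_const_mul' _ _ ENNReal.ofReal_ne_top]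
    have h0 := (hflux 0 hfin0).trans (ENNReal.toReal_mono htop (le_add_right (le_add_right (le_add_right le_rfl))))
    have h1 := (hflux s hfins).trans (ENNReal.toReal_mono htop (le_add_right (le_add_right (le_add_left le_rfl))))
    calc ∫ u in Ioc 0 s, ∫ y, W (L u y) * b (L u y) = (∫ u in Ioc 0 s, ((∫ y, W (L u y) * b (L u y)) - ∫ y, W (L u y) * dV (L u y))) +
          ∫ u in Ioc 0 s, ∫ y, W (L u y) * dV (L u y) := by rw [integral_sub hIb hId, sub_add_cancel]
      _ ≤ (972 * Stot).toReal + (2⁻¹ * (∫ y, W (L 0 y) * |h (L 0 y)|) + 2⁻¹ * (∫ y, W (L s y) * |h (L s y)|)) := add_le_add herr hV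
      _ ≤ A := by rw [hA]; linarith
  have hslab := slab_lintegral_le_of_weighted_le M (4 * M) F b s A hM (by positivity) hF.continuous hs (fun x _ ↦ ⟨hbc.continuousAt, hb0 x⟩) hweighted
  have hAS : ENNReal.ofReal A = 973 * Stot := by
    rw [hA, ENNReal.toReal_mul, show ((972 : ℝ≥0∞).toReal * Stot.toReal + 2⁻¹ * Stot.toReal + 2⁻¹ * Stot.toReal) = 973 * Stot.toReal by norm_num; ring,
      ENNReal.ofReal_mul (by norm_num), ENNReal.ofReal_toReal htop, ENNReal.ofReal_ofNat]
  have hmidm : MeasurableSet mid := (isClosed_le continuous_const continuous_norm).measurableSet.inter (isClosed_le continuous_norm continuous_const).measurableSet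
  have hsub : mid ⊆ {y : E3 | 2 * M < ‖y‖ ∧ ‖y‖ ≤ 4 * M} := fun y hy ↦ ⟨by linarith [hy.1], by linarith [hy.2]⟩
  have hptw : ∀ u, ∀ y ∈ mid, G2 u y ≤ 6 * ENNReal.ofReal (b (L u y)) := fun u y hy ↦ by
    simp only [hG2, hb, hLrad, show θ ‖y‖ = 1 from (photonSphere_cutoff_facts hM ‖y‖).2.1 hy.1 hy.2, one_mul]
    rw [← ENNReal.ofReal_ofNat, ← ENNReal.ofReal_mul (by norm_num)]
    exact ENNReal.ofReal_le_ofReal (by linarith)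
  calc ∫⁻ u in Ioc 0 s, ∫⁻ y in mid, G2 u y ≤ ∫⁻ u in Ioc 0 s, ∫⁻ y in mid, 6 * ENNReal.ofReal (b (L u y)) := lintegral_mono fun u ↦ setLIntegral_mono' hmidm (hptw u)
    _ ≤ ∫⁻ u in Ioc 0 s, 6 * ∫⁻ y in {y : E3 | 2 * M < ‖y‖ ∧ ‖y‖ ≤ 4 * M}, ENNReal.ofReal (b (L u y)) := by
        refine lintegral_mono fun u ↦ ?_
        rw [lintegral_const_mul' _ _ (by norm_num)]
        exact mul_le_mul' le_rfl (lintegral_mono_set hsub)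
    _ = 6 * ∫⁻ u in Ioc 0 s, ∫⁻ y in {y : E3 | 2 * M < ‖y‖ ∧ ‖y‖ ≤ 4 * M}, ENNReal.ofReal (b (L u y)) := lintegral_const_mul' _ _ (by norm_num)
    _ ≤ 6 * ENNReal.ofReal A := mul_le_mul' le_rfl hslab
    _ = ((5838 : NNReal) : ℝ≥0∞) * Stot := by rw [hAS, ← mul_assoc, ENNReal.coe_ofNat]; norm_num

/-- **Stub `restFrame_photonSphere_timeDeriv_le`** (crux `stmt-FinalStateConjecture-14310`, line `Sketch`): photon-sphere control
of the time derivative `∂₀Φ` of a `C²` function on the leaves of the static tails-cut Schwarzschild zone by the two end-leaf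
`(∂₀Φ)²`-integrals, the shell integrals of `(∂₀Φ)²` and the annulus integral of `M² (∂_{r⋆}∂₀Φ)² + (r − 3M)² (∂₀∂₀Φ)²`
(`photonSphere_timeDeriv_le_of_contDiff` with `g = ∂₀Φ ∈ C¹`). Dafermos–Rodnianski arXiv:0811.0354, §4.1. [folklore] -/
theorem restFrame_photonSphere_timeDeriv_le : ∀ (M : ℝ), 0 < M → ∃ K : NNReal, ∀ (F : E3 → ℝ) (Φ : E4 → ℝ) (s : ℝ), ContDiff ℝ 2 F → (∀ y, ‖fderiv ℝ F y‖ ≤ 2⁻¹) → ContDiff ℝ 2 Φ → 0 ≤ s → ∫⁻ u in Set.Ioc 0 s, ∫⁻ y in {y : E3 | 5 * M / 2 ≤ ‖y‖ ∧ ‖y‖ ≤ 7 * M / 2}, ENNReal.ofReal (fderiv ℝ Φ (E4.ofTimeSpace (u + F y) y) (E4.basisVector 0) ^ 2) ≤ (K : ENNReal) * (ENNReal.ofReal M * (∫⁻ y in {y : E3 | 2 * M < ‖y‖}, ENNReal.ofReal (fderiv ℝ Φ (E4.ofTimeSpace (0 + F y) y) (E4.basisVector 0) ^ 2)) + ENNReal.ofReal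 M * (∫⁻ y in {y : E3 | 2 * M < ‖y‖}, ENNReal.ofReal (fderiv ℝ Φ (E4.ofTimeSpace (s + F y) y) (E4.basisVector 0) ^ 2)) + (∫⁻ u in Set.Ioc 0 s, ∫⁻ y in {y : E3 | (9 * M / 4 ≤ ‖y‖ ∧ ‖y‖ ≤ 5 * M / 2) ∨ (7 * M / 2 ≤ ‖y‖ ∧ ‖y‖ ≤ 15 * M / 4)}, ENNReal.ofReal (fderiv ℝ Φ (E4.ofTimeSpace (u + F y) y) (E4.basisVector 0) ^ 2)) + (∫⁻ u in Set.Ioc 0 s, ∫⁻ y in {y : E3 | 9 * M / 4 ≤ ‖y‖ ∧ ‖y‖ ≤ 15 * M / 4}, ENNReal.ofReal (M ^ 2 * ((1 - (Real.smoothTransition (2 - Kerr.radius 0 (E4.ofTimeSpace (u + F y) y) / (8 * M)) * (2 * Kerr.scalarH M 0 (E4.ofTimeSpace (u + F y) y)))) * (∑ i : Fin 3, (E4.ofTimeSpace (u + F y) y) i.succ * fderiv ℝ (fun z ↦ fderiv ℝ Φ z (E4.basisVector 0)) (E4.ofTimeSpace (u + F y) y) (E4.basisVector i.succ)) / Kerr.radius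 0 (E4.ofTimeSpace (u + F y) y) + (Real.smoothTransition (2 - Kerr.radius 0 (E4.ofTimeSpace (u + F y) y) / (8 * M)) * (2 * Kerr.scalarH M 0 (E4.ofTimeSpace (u + F y) y))) * fderiv ℝ (fun z ↦ fderiv ℝ Φ z (E4.basisVector 0)) (E4.ofTimeSpace (u + F y) y) (E4.basisVector 0)) ^ 2 + (‖y‖ - 3 * M) ^ 2 * fderiv ℝ (fun z ↦ fderiv ℝ Φ z (E4.basisVector 0)) (E4.ofTimeSpace (u + F y) y) (E4.basisVector 0) ^ 2))) := by
  intro M hM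
  refine ⟨5838, fun F Φ s hF hdF hΦ hs ↦ ?_⟩
  exact photonSphere_timeDeriv_le_of_contDiff M hM F (fun z ↦ fderiv ℝ Φ z (E4.basisVector 0)) s hF hdF
    ((hΦ.fderiv_right (m := 1) le_rfl).clm_apply contDiff_const) hs

end Summit.FinalStateConjecture.FinalStateConjecture.Theorems

end
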